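import Summits.QuantumFields.YangMills.Theorems.BalabanUVNodesN27AtRecord13CoPHHolder
import Summits.QuantumFields.YangMills.Theorems.BalabanUVNodesN16LinesAllTorusAtRecord13CoPH

/-!
# BalabanUVNodes ∕ N27 = binder B5 AT THE RECORD — THE READING STOREY AT NODE N16's CURRENCY OF RECORD «R-β» WITH THE N16 SLOT PRODUCED IN THE (D)ʰ WINDOW-LINEAR
# ALL-TORUS CURRENCY, LETTERS GIVEN (dag-n16-e 36ᴴ `…N16LinesAllTorusAtRecord13CoPH` §2 `s_N16Holder_readingOfRecord₁₃CoPHOn_of_window_linear_allTorus`): the WINDOW twin of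
# (Q) §3 `spine_rec13CCoPHOn_at_readingOfRecord₁₃CoPH_holder_of_thm33Letters` and of dag-n17-w3's EDGES twin `…_holder_of_edges` (p585820) — node N05's CONJUNCTS
# `B8.Thm4Body` ∕ `B8.Prop3Body` at exponent `β` on the pinned all-torus proper sub-index + node N07's linear leaf `LeafH3sup` at the slice letters `(ℓ F).ε, b′, c′`, under the
# twenty-one DISPLAYED linear-window letter clauses of 36ᴴ at a GIVEN letter family `ℓ : T4Family → NE3Letters₁₁` (no `∃ ℓ₃`)
# (cell `pub-ymgap`, HUMAN RULING D-0062 Track A; director-ym №197 ∕ HUMAN RULING D-0149 width seats; seat `pub-ymgap-dag-n22-w2` RE-POINTED to row N27 (W-a) «WINDOW twin» by plan g79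
# WORDS-2 (3) № 3 (W-SEAT-START-LIST v5∕v6 § n27 item 1); K3⁷ `SpineGivenEndpointR13SepCoPH` = stmt-QuantumFields-20544, `--kind proof --supports 20544 --as helper`; COUNT-NEUTRAL;
# THEOREMS ONLY, 0 `def`, 0 `sorry`; `N`-generic, regime-generic, NO Theses import — the item-facing face is the sibling route-facing leaf `…N27SpineGivenEndpointR13SepCoPHHolderN16Window`)

THE KIT PATTERN (plan v4∕v5 §n27: «slice the TREE parent, swap ONE producer face»).  PARENT = (Q) `…N27AtRecord13CoPHHolder` (dag-n27-c g10, p581033) §2 ★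
`spine_rec13CCoPHOn_at_readingOfRecord₁₃CoPH_holder` (N27 = B5 at the regime record class from the stubs at the regime home of dag-n22-e's reading of record
`readingOfRecord₁₃CoPH w1 ℓ₃ ne2 ne1`, node N16's stub in the currency of record R-β `S_N16Holder β (RRec₁₃CoPHOn … Rg)`, N17 ELIMINATED by dag-n17-a `YMDAG.N17.s_N17_of_D4_N18`, the N19′
edge reading dag-n16-e 41ᴴ's `RatesHolderAt … β`).  THE ONE FACE SWAPPED: (Q) §3 produces `h16` by dag-n16-e 40ᴮ §2 (letters chosen, `∃ ℓ₃`); dag-n17-w3's EDGES twin by 37ᴴ §2 (letters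
chosen); HERE `h16` is produced by dag-n16-e 36ᴴ §2 `s_N16Holder_readingOfRecord₁₃CoPHOn_of_window_linear_allTorus` AT A GIVEN LETTER FAMILY `ℓ` — the (D)ʰ window-LINEAR all-torus road:
per family the linear window letters `len c₁ c₁' B₁' cP C₂ B₀β inp α b' c'` with their twenty-one displayed clauses `hlen hlen1 hB₁' hBB hc₁' hwin hα hα1 hα2 hα3 hα4 hα5 hg hε0 hε hΛ₁r hb hC
hΛ₂' hb' hc'` (36ᴴ's section binders VERBATIM), `0 ≤ β ≤ 1`, and the CONTENT `hcontent` once per GUARDED family carrying an admissible tuple: node N05's `B8.Thm4Body (c₁ F) (B₁' F) (…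
zdGF3 (M_N ℂ) F.L β (len F) i.1 …)` ∧ `B8.Prop3Body (cP F) 4 F.L (C₂ F) (inp F) (B₀β F) (…)` on the PINNED all-torus proper sub-index and node N07's `LeafH3sup 4 F.L (ne3NperOfRecord₁₁ F 0 0)
(ℓ F).ε (b' F) (c' F) (ne3DomOfRecord₁₁ F N 0 0)`.  Since `ℓ` is GIVEN, the home-keyed N19′ edge `h19` is asked AT THAT `ℓ` (not for every `ℓ₃` as in the `∃`-letter twins).  EVERY
OTHER BINDER AND THE CONCLUSION VERBATIM from (Q) §2 in guarded θ-form (dag-n22-e's `s_N1x_rRec₁₃CoPHOn_iff` unfoldings, as in the Edges twin); proof = (Q) §2 at `ℓ` with `h16 := 36ᴴ …`.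
(Q), 36ᴴ, 37ᴴ, 40ᴮ, the Edges twins and every landed declaration UNTOUCHED (additive file); nothing re-declared.

WHAT IS KERNEL-CHECKED ([bookkeeping]; 0 `def`, 0 `sorry`):
* §1 ★★ `spine_rec13CCoPHOn_at_readingOfRecord₁₃CoPH_holder_of_window_linear` — N27 = B5 at node00-def-RR-2's regime record class `IsRecordOfRecord₁₃CCoPHOn F N Rg` from: NE1′ on
  `ne1`, NE2 on `ne2`, NE5 ∕ NE9 ∕ (D4) on the reading's `u3Objects` (guarded θ-form), N16 AT EXPONENT `β` ⟸ 36ᴴ from the window letters + content, N17 eliminated, N20 ∕ N21 ∕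
  extraction displayed, the N19′ edge reading `RatesHolderAt … β` at `ℓ`.

HONEST FRAMING.  COMPOSITE-node bookkeeping BY NAME; no estimate of its own.  Node N05's leaf bodies ([Balaban1985RegularSpaces] Thm 4 ∕ Prop 3 in the tree's `B8.Thm4Body` ∕ `B8.Prop3Body`
dress at exponent `β`), node N07's linear `LeafH3sup`, the twenty-one window clauses (a LINEAR window: `b′ ≤ α∕2048`, `c′ ≤ α∕24`, `α ≤ 10⁻⁹`, …), NE1′ ∕ NE2 ∕ NE5 ∕ NE9 ∕ (D4), NE7 ∕ NE7b ∕
NE7c and the extraction clause are HYPOTHESES asserted for no family (the children's open obligations; 0∕1 at the ₁₃ record today — K0⁷ OPEN, no `Provisos₁₃CoPH` inhabitant claimed);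
A6 (standing line, seat's own p584015 «WINDOW-N22-J»): at a regime `Rg` WITHOUT a window clause the binder `h22` (N22 at every admissible tuple) is only inhabitable through a road
covering `θ.γ² ≥ ½` — the J-road does not; displayed, not hidden.  `β` a LETTER (`0 ≤ β ≤ 1` here; the consumers' window `2∕3 < β < 1` is theirs); NE3 at exponent β NOT PROVED;
nothing of Bałaban's asserted or instantiated; N05 ∕ N07 ∕ N16 ∕ N17 ∕ N27 NOT discharged; K3⁷ NOT claimed; counts UNMOVED (typed 28∕28 · discharged 5∕27, A 5∕28).  One finite
four-torus programme at fixed `ε` per run — R4 closes the conditional rung `BalabanLadder.UV` only; NOT ℝ⁴, NOT infinite volume, NOT OS, NOT a mass gap, NOT Clay.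
No decl below carries a cite tag.
-/

set_option autoImplicit false

namespace Summit.QuantumFields.YangMills.Theorems.BalabanUVNodesN27SpineRecord

open scoped Matrix.Norms.L2Operator

open Literature.MathematicalPhysics.QuantumFieldTheory.Balaban1983to89
open Literature.MathematicalPhysics.QuantumFieldTheory.Balaban1983to89.T4Continuum
open T4ContinuumYM4Torus (ForSmallCouplings)
open Summit.QuantumFields.BalabanUV.T4Continuum.Spine
open YMDAG.UVSplit
open Node00 (Stage13HParams datumOfRecord₁₃CoPH IsRecordOfRecord₁₃CCoPH IsDatumOfRecord₁₃CCoPH NE3Letters₁₁ NE2Objects₁₁ ne3ConstLayerOfRecord₁₁ MatA)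
open Node00.W1 (ReadingData)
open T4WeightBudget (RelWeightBound)
open T4IndicatorShell (ShellWeightBound)
open B7Prop1Explicit B7Prop2Explicit
open B7Prop3Flat (c3)
open B8LeafModelZd (ZdIdx)
open B8LeafModelZd3 (zdGF3)
open Node00 (ne3NperOfRecord₁₁ ne3DomOfRecord₁₁)
open Summit.QuantumFields.BalabanUV.T4Continuum
open BlockAverageCurrent (curConst)
open NE3RightInverseSupLetters (frameC)
open Summit.QuantumFields.BalabanUV.T4Continuum.NE3.LeafIndexSockets (LeafH3sup)
open Summit.QuantumFields.YangMills.BalabanUVNodes.N16HolderDefs (N16HolderAt S_N16Holder)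
open Summit.QuantumFields.YangMills.BalabanUVNodes.N16HolderRegime (radiusOfRecordH constOfRecordH)
open Summit.QuantumFields.YangMills.BalabanUVNodes.SpineRatesHolder (RatesHolderAt)

variable {N : ℕ} [NeZero N] (cr : SpineReading₁₃CoPH N)

/-! ## §1 The N16 slot AT EXPONENT `β` produced in the (D)ʰ WINDOW-LINEAR all-torus currency at GIVEN letters `ℓ` (dag-n16-e 36ᴴ §2; `0 ≤ β ≤ 1`) -/

section Window

variable (w1 : (F : T4Family) → (θ : Stage13HParams F N) → Node00.W1.ReadingData F (Node00.MatA N) θ.τ9.M)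
  (ne2 : (F : T4Family) → Stage13HParams F N → (ℕ → ℝ) → List (ULoop F) → ℕ → NE2Objects₁₁)
  (ne1 : (F : T4Family) → Stage13HParams F N → (ℕ → ℝ) → List (ULoop F) → NE1pCarriers)
  (Rg : (F : T4Family) → Stage13HParams F N → Prop) (ℓ : T4Family → NE3Letters₁₁)
  {len : T4Family → Site 4 → ℝ} {c₁ c₁' B₁' cP C₂ B₀β : T4Family → ℝ} {inp : T4Family → B8.B9Inputs} {α b' c' : T4Family → ℝ}

/-- ★★ **N27 = B5 AT THE REGIME RECORD CLASS FROM THE SLOTS AT THE REGIME HOME OF THE READING OF RECORD, THE N16 SLOT IN THE CURRENCY OF RECORD R-β PRODUCED IN THE (D)ʰ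
WINDOW-LINEAR ALL-TORUS CURRENCY AT GIVEN LETTERS `ℓ`** ((Q) §3's ∕ the Edges twin's WINDOW twin: `h16` ⟸ dag-n16-e 36ᴴ §2
`s_N16Holder_readingOfRecord₁₃CoPHOn_of_window_linear_allTorus` from the twenty-one linear-window letter clauses `hlen … hc'`, `hβ0 hβ1` and the content `hcontent` (node N05's
`B8.Thm4Body` ∕ `B8.Prop3Body` at exponent `β` on the pinned all-torus proper sub-index ∧ node N07's `LeafH3sup` at `((ℓ F).ε, b′ F, c′ F)`, once per guarded family); the other rate
slots in guarded θ-form (dag-n22-e `s_N1x_rRec₁₃CoPHOn_iff`), N17 eliminated (dag-n17-a `YMDAG.N17.s_N17_of_D4_N18` inside (Q) §2), the N19′ edge reading dag-n16-e 41ᴴ's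
`RatesHolderAt … β` AT `ℓ`); at `Rg :=` the item's guard, `N = 2` THE ITEM follows by leaf A §4 (sibling route-facing leaf).  Every hypothesis 0∕1 today; NE3 at exponent β NOT PROVED;
N05 ∕ N07 ∕ N16 ∕ N27 NOT discharged. [bookkeeping] -/
theorem spine_rec13CCoPHOn_at_readingOfRecord₁₃CoPH_holder_of_window_linear {β : ℝ} (hβ0 : 0 ≤ β) (hβ1 : β ≤ 1)
    (hlen : ∀ (F : T4Family) (v : Site 4), 0 < len F v → 1 ≤ len F v) (hlen1 : ∀ (F : T4Family) (μ : Fin 4), len F (e μ) = 1)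
    (hB₁' : ∀ F, 0 < B₁' F) (hBB : ∀ F : T4Family, 5 * ((4 : ℕ) : ℝ) * F.L * (inp F).B₀ ≤ B₁' F) (hc₁' : ∀ F, 0 < c₁' F)
    (hwin : ∀ (F : T4Family) (α₀ α₁ : ℝ), 0 < α₀ → 0 < α₁ → α₀ + α₁ ≤ c₁' F →
      α₀ + α₁ ≤ c₁ F ∧ C0 4 * (2 * α₀) ≤ 1 / 3 ∧ 4 * α₀ ≤ c2' 4 F.L ∧ 16 * (B₁' F * (α₀ + α₁)) ≤ 1 ∧
      Real.exp (4 * (800 * (((4 : ℕ) : ℝ) + 1) ^ 2 * (((4 : ℕ) : ℝ) + 4)) * α₀) * (1 + 8 * (131072 * (((4 : ℕ) : ℝ) + 1) ^ 2) * (B₁' F * (α₀ + α₁))) ≤ 2 ∧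
      2 * (B₁' F * (α₀ + α₁)) ≤ c3 4 F.L ∧ ((4 : ℕ) : ℝ) * F.L * α₁ ≤ 1 / 8 ∧ α₀ ≤ cP F ∧ α₁ ≤ cP F ∧ B₁' F * (α₀ + α₁) ≤ cP F ∧
      2 * (B₁' F * (α₀ + α₁)) ^ 2 + 20 * ((4 : ℕ) : ℝ) * α₀ * (B₁' F * (α₀ + α₁)) + 2 * C₂ F * (B₁' F * (α₀ + α₁)) ^ 2 ≤ α₀ + α₁)
    (hα : ∀ F, 0 < α F) (hα1 : ∀ F, α F ≤ c₁' F / 177)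
    (hα2 : ∀ F : T4Family, α F ≤ (ℓ F).Λ₁ / (1770 * (5 * ((4 : ℕ) : ℝ) * F.L * (inp F).B₀) + 1))
    (hα3 : ∀ F : T4Family, α F ≤ c2' 4 F.L / 2)
    (hα4 : ∀ F : T4Family, α F ≤ 1 / ((23040 * (4 : ℝ) ^ 4 * (frameC 4 F.L + 4) ^ 3 + 12) * (1 + curConst 4 F.L) + 1))
    (hα5 : ∀ F, α F ≤ 1 / 10 ^ 9)
    (hg : ∀ F, 0 < (ℓ F).g) (hε0 : ∀ F, 0 < (ℓ F).ε) (hε : ∀ F, (ℓ F).ε < α F)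
    (hΛ₁r : ∀ F : T4Family, (ℓ F).Λ₁ ≤ radiusOfRecordH N F.L (ne3NperOfRecord₁₁ F 0 0))
    (hb : ∀ F, 0 ≤ (ℓ F).b ∧ (ℓ F).b ≤ (ℓ F).ε / 2) (hC : ∀ F : T4Family, constOfRecordH N F.L (ne3NperOfRecord₁₁ F 0 0) (ℓ F).g ≤ (ℓ F).C)
    (hΛ₂' : ∀ F : T4Family, 177 * α F * (5 * ((4 : ℕ) : ℝ) * F.L * B₀β F + 5 * ((4 : ℕ) : ℝ) * F.L * (inp F).B₀) ≤ (ℓ F).Λ₂')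
    (hb' : ∀ F, 0 ≤ b' F ∧ b' F ≤ α F / 2048) (hc' : ∀ F, 0 ≤ c' F ∧ c' F ≤ α F / 24)
    (hcontent : ∀ (F : T4Family), (∃ θ : Stage13HParams F N, θ.Provisos₁₃CoPH F N ∧ Rg F θ ∧ θ.Admissible F N) →
      letI : CStarAlgebra (Matrix (Fin N) (Fin N) ℂ) := {}
      B8.Thm4Body (c₁ F) (B₁' F) (fun i : {i : ZdIdx 4 F.L // (∀ j, i.Ω j = Set.univ) ∧ (∀ m j, i.Λs m j = {_y | j = m}) ∧ (∀ m j, i.Λb m j = {_c | j = m}) ∧ i.η = ((F.L : ℝ)⁻¹) ^ i.k} => (zdGF3 (Matrix (Fin N) (Fin N) ℂ) F.L β (len F) i.1).toGFData) ∧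
        B8.Prop3Body (cP F) 4 (F.L : ℝ) (C₂ F) (inp F) (B₀β F)
          (fun i : {i : ZdIdx 4 F.L // (∀ j, i.Ω j = Set.univ) ∧ (∀ m j, i.Λs m j = {_y | j = m}) ∧ (∀ m j, i.Λb m j = {_c | j = m}) ∧ i.η = ((F.L : ℝ)⁻¹) ^ i.k} => (zdGF3 (Matrix (Fin N) (Fin N) ℂ) F.L β (len F) i.1).toGFData2) ∧
        LeafH3sup 4 F.L (ne3NperOfRecord₁₁ F 0 0) (ℓ F).ε (b' F) (c' F) (ne3DomOfRecord₁₁ F N 0 0))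
    (h14 : ∀ (F : T4Family) (θ : Stage13HParams F N), θ.Provisos₁₃CoPH F N → Rg F θ → θ.Admissible F N → ∀ (g₀ : ℕ → ℝ) (os : List (ULoop F)),
      N14At (ne1 F θ g₀ os))
    (h15 : ∀ (F : T4Family) (θ : Stage13HParams F N), θ.Provisos₁₃CoPH F N → Rg F θ → θ.Admissible F N → ∀ (g₀ : ℕ → ℝ) (os : List (ULoop F)) (k : ℕ),
      N15At (ne2OfRecord₁₁ (ne2 F θ g₀ os k)))
    (h18 : ∀ (F : T4Family) (θ : Stage13HParams F N), θ.Provisos₁₃CoPH F N → Rg F θ → θ.Admissible F N → ∀ k : ℕ,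
      N18At (u3OfRecord₁₃ θ.toStage13Params ((w1 F θ).u3Objects θ.γ) k))
    (h22 : ∀ (F : T4Family) (θ : Stage13HParams F N), θ.Provisos₁₃CoPH F N → Rg F θ → θ.Admissible F N → ∀ k : ℕ,
      N22At (u3OfRecord₁₃ θ.toStage13Params ((w1 F θ).u3Objects θ.γ) k))
    (hD4 : ∀ (F : T4Family) (θ : Stage13HParams F N) (hP : θ.Provisos₁₃CoPH F N), Rg F θ → θ.Admissible F N → ∀ k : ℕ,
      ReadOutAt (datumOfRecord₁₃CoPH F N θ hP) (u3OfRecord₁₃ θ.toStage13Params ((w1 F θ).u3Objects θ.γ) k))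
    (h20 : S_N20 (SRec₁₃CoPHOn cr Rg)) (h21 : S_N21 (SRec₁₃CoPHOn cr Rg))
    (hx : ∀ (F : T4Family) (θ : Stage13HParams F N) (hP : θ.Provisos₁₃CoPH F N), Rg F θ → θ.Admissible F N →
      B16.EndStatementBPrinted (datumOfRecord₁₃CoPH F N θ hP).C → DagBinding.EndpointExistence (datumOfRecord₁₃CoPH F N θ hP).C.toB12 →
        ForSmallCouplings (datumOfRecord₁₃CoPH F N θ hP) fun g₀ => ∀ os : List (ULoop F),
          0 < (cr F θ hP g₀ os).l₀ ∧ 0 < (cr F θ hP g₀ os).vol ∧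
          (∀ (K : ℕ) (t : ℝ), |t| ≤ (cr F θ hP g₀ os).l₀ →
            T4GenFunBounds.schemeZ ((datumOfRecord₁₃CoPH F N θ hP).scheme g₀) os ((cr F θ hP g₀ os).K₀ + K) t =
              ∑ τ ∈ (cr F θ hP g₀ os).T K, (cr F θ hP g₀ os).A K t τ) ∧
          (∀ (K : ℕ) (t : ℝ), |t| ≤ (cr F θ hP g₀ os).l₀ →
            T4GenFunBounds.schemeZ ((datumOfRecord₁₃CoPH F N θ hP).scheme g₀) os ((cr F θ hP g₀ os).K₀ + K + 1) t =
              ∑ τ ∈ (cr F θ hP g₀ os).T K, (cr F θ hP g₀ os).B K t τ))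
    (h19 : ∀ (F : T4Family) (θ : Stage13HParams F N) (hP : θ.Provisos₁₃CoPH F N), Rg F θ → θ.Admissible F N → ∀ (g₀ : ℕ → ℝ) (os : List (ULoop F)),
      (∀ k : ℕ, RatesHolderAt (datumOfRecord₁₃CoPH F N θ hP) (rateCarriersOfRecord₁₃CoPH (readingOfRecord₁₃CoPH w1 ℓ ne2 ne1) F θ hP g₀ os k) β) → letI := (cr F θ hP g₀ os).dec
        ∃ δ : ℕ → ℝ, NE7.Core (cr F θ hP g₀ os).l₀ (cr F θ hP g₀ os).vol (cr F θ hP g₀ os).T (cr F θ hP g₀ os).Bad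
          (fun K t τ => (cr F θ hP g₀ os).A K t τ - (cr F θ hP g₀ os).shA K t τ) (fun K t τ => (cr F θ hP g₀ os).B K t τ - (cr F θ hP g₀ os).shB K t τ) δ ∧
          Summable δ) :
    Spine (N := N) fun F D w => Node00.IsRecordOfRecord₁₃CCoPHOn F N Rg D w :=
  spine_rec13CCoPHOn_at_readingOfRecord₁₃CoPH_holder cr β w1 ne2 ne1 Rg ℓ
    ((s_N14_rRec₁₃CoPHOn_iff _ Rg).mpr fun F θ hP hRg hθ g₀ os => h14 F θ hP hRg hθ g₀ os)
    ((s_N15_rRec₁₃CoPHOn_iff _ Rg).mpr fun F θ hP hRg hθ g₀ os k => h15 F θ hP hRg hθ g₀ os k)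
    (Summit.QuantumFields.YangMills.BalabanUVNodes.N16LinesAllTorusAtRecord13CoPH.s_N16Holder_readingOfRecord₁₃CoPHOn_of_window_linear_allTorus
      β Rg ℓ w1 ne2 ne1 hlen hlen1 hB₁' hBB hc₁' hwin hα hα1 hα2 hα3 hα4 hα5 hg hε0 hε hΛ₁r hb hC hΛ₂' hb' hc' hβ0 hβ1 hcontent)
    ((s_N18_rRec₁₃CoPHOn_iff _ Rg).mpr fun F θ hP hRg hθ _ _ k => h18 F θ hP hRg hθ k)
    ((s_N22_rRec₁₃CoPHOn_iff _ Rg).mpr fun F θ hP hRg hθ _ _ k => h22 F θ hP hRg hθ k)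
    ((s_D4_rRec₁₃CoPHOn_iff _ Rg).mpr fun F θ hP hRg hθ _ _ k => hD4 F θ hP hRg hθ k) h20 h21 hx h19

end Window

end Summit.QuantumFields.YangMills.Theorems.BalabanUVNodesN27SpineRecord
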